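import Literature.Topology.FourManifolds.TautFoliationsFences
import HarnessLib

/-!
# Concatenation of fences over the unit interval

Topic: codimension-one `C⁰` foliations, fences (`TautFoliationsFences.lean`). Two fences
`Φ₁`, `Φ₂` over the unit interval `I`, for germ paths `Γ₁ : d₀ ⟶ d₁`, `Γ₂ : d₁ ⟶ d₂` at the same
level `τ₀` and radius `ε`, whose verticals at the junction agree (`Φ₁ 1 τ = Φ₂ 0 τ`),
**concatenate to a fence over `I` for the concatenated germ path `Γ₁.trans Γ₂`**, at any smaller
radius `ε' < ε` (`IsFenceOn.trans`). Away from the junction this is a reparametrisation; at the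
junction, the local datum of `Φ₁` at `1` also serves for `Φ₂` near `0`: the two local first
integrals agree near the common base point (they are the germ `d₁`), and the height of `Φ₂ s τ`
in the box of that datum is constant in `s` for small `s` — it is locally a function of the
height in the box of the datum of `Φ₂`, which is constant, and `[0, s]` is connected (a tube
lemma makes this uniform in `τ` on the compact level range `[τ₀ - ε', τ₀ + ε']`). This is the
elementary step by which fences along consecutive arcs (edges, corners) of a walk are assembled.

* `fstHalf`, `sndHalf`, `transFence` (**definitions**); `transFence_of_le`, `transFence_of_gt`,
  `Path.trans_apply_of_le`, `Path.trans_apply_of_ge` (**proved**);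
* `LocalDatum.transfer` (**definition**): pulling a local datum back along a reparametrisation;
* `IsFenceOn.height_eq_of_path` (**proved**): constancy of the height in a second box along a
  path of constant height in a first box;
* `IsFenceOn.trans` (**proved**).

## References

* C. Camacho, A. Lins Neto, *Geometric Theory of Foliations*, Birkhäuser (1985), Ch. IV §2
  [CamachoLinsNeto1985].
-/

noncomputable section

open Set Filter Function Topology unitInterval

namespace Literature.Topology.FourManifolds

namespace Foliation

variable {B : Type*} [NormedAddCommGroup B] {M : Type*} [TopologicalSpace M] {F : Foliation B M}

/-! ## Reparametrisations of the two halves -/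

/-- The parameter of the first half: `θ ↦ 2θ`, clamped to `I`. [folklore] -/
def fstHalf (θ : I) : I := projIcc 0 1 zero_le_one (2 * θ)

/-- The parameter of the second half: `θ ↦ 2θ - 1`, clamped to `I`. [folklore] -/
def sndHalf (θ : I) : I := projIcc 0 1 zero_le_one (2 * θ - 1)

/-- `fstHalf` is continuous. [folklore] -/
theorem continuous_fstHalf : Continuous fstHalf :=
  continuous_projIcc.comp (continuous_const.mul continuous_subtype_val)

/-- `sndHalf` is continuous. [folklore] -/
theorem continuous_sndHalf : Continuous sndHalf :=
  continuous_projIcc.comp ((continuous_const.mul continuous_subtype_val).sub continuous_const)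

/-- The value of `fstHalf` on the first half. [folklore] -/
theorem coe_fstHalf {θ : I} (h : (θ : ℝ) ≤ 1 / 2) : (fstHalf θ : ℝ) = 2 * θ := by
  rw [fstHalf, projIcc_of_mem _ ⟨by linarith [θ.2.1], by linarith⟩]

/-- The value of `sndHalf` on the second half. [folklore] -/
theorem coe_sndHalf {θ : I} (h : 1 / 2 ≤ (θ : ℝ)) : (sndHalf θ : ℝ) = 2 * θ - 1 := by
  rw [sndHalf, projIcc_of_mem _ ⟨by linarith, by linarith [θ.2.2]⟩]

/-- `fstHalf (1/2) = 1`. [folklore] -/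
theorem fstHalf_eq_one {θ : I} (h : (θ : ℝ) = 1 / 2) : fstHalf θ = 1 :=
  Subtype.ext (by rw [coe_fstHalf h.le, h]; norm_num)

/-- `sndHalf (1/2) = 0`. [folklore] -/
theorem sndHalf_eq_zero {θ : I} (h : (θ : ℝ) = 1 / 2) : sndHalf θ = 0 :=
  Subtype.ext (by rw [coe_sndHalf h.ge, h]; norm_num)

/-- `fstHalf 0 = 0`. [folklore] -/
@[simp] theorem fstHalf_zero : fstHalf 0 = 0 := Subtype.ext (by rw [coe_fstHalf (by norm_num)]; simp)

/-- `sndHalf 1 = 1`. [folklore] -/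
@[simp] theorem sndHalf_one : sndHalf 1 = 1 := Subtype.ext (by rw [coe_sndHalf (by norm_num)]; norm_num)

/-- The concatenated path on the first half. [folklore] -/
theorem _root_.Path.trans_apply_of_le {Y : Type*} [TopologicalSpace Y] {a b c : Y} (γ : Path a b) (γ' : Path b c)
    {θ : I} (h : (θ : ℝ) ≤ 1 / 2) : (γ.trans γ') θ = γ (fstHalf θ) := by
  rw [Path.trans_apply, dif_pos h]
  exact congrArg γ (Subtype.ext (coe_fstHalf h).symm)

/-- The concatenated path on the second half. [folklore] -/
theorem _root_.Path.trans_apply_of_ge {Y : Type*} [TopologicalSpace Y] {a b c : Y} (γ : Path a b) (γ' : Path b c)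
    {θ : I} (h : 1 / 2 ≤ (θ : ℝ)) : (γ.trans γ') θ = γ' (sndHalf θ) := by
  rcases h.eq_or_lt with h' | h'
  · rw [Path.trans_apply, dif_pos h'.symm.le, sndHalf_eq_zero h'.symm, γ'.source]
    calc γ ⟨2 * θ, _⟩ = γ 1 := congrArg γ (Subtype.ext (by show 2 * (θ : ℝ) = 1; linarith))
      _ = b := γ.target
  · rw [Path.trans_apply, dif_neg (not_le.2 h')]
    exact congrArg γ' (Subtype.ext (coe_sndHalf h).symm)

/-! ## The concatenated fence -/

/-- **The concatenated fence**: `Φ₁` reparametrised on `[0, 1/2]`, `Φ₂` on `(1/2, 1]`. [folklore] -/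
def transFence (Φ₁ Φ₂ : I → ℝ → M) (θ : I) : ℝ → M :=
  if (θ : ℝ) ≤ 1 / 2 then Φ₁ (fstHalf θ) else Φ₂ (sndHalf θ)

omit [TopologicalSpace M] in
/-- The concatenated fence on the first half. [folklore] -/
theorem transFence_of_le {Φ₁ Φ₂ : I → ℝ → M} {θ : I} (h : (θ : ℝ) ≤ 1 / 2) :
    transFence Φ₁ Φ₂ θ = Φ₁ (fstHalf θ) := if_pos h

omit [TopologicalSpace M] in
/-- The concatenated fence on the open second half. [folklore] -/
theorem transFence_of_gt {Φ₁ Φ₂ : I → ℝ → M} {θ : I} (h : 1 / 2 < (θ : ℝ)) :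
    transFence Φ₁ Φ₂ θ = Φ₂ (sndHalf θ) := if_neg (not_le.2 h)

omit [TopologicalSpace M] in
/-- The concatenated fence on the closed second half, at levels where the junction verticals
agree. [folklore] -/
theorem transFence_of_ge {Φ₁ Φ₂ : I → ℝ → M} {θ : I} (h : 1 / 2 ≤ (θ : ℝ)) {τ : ℝ} (hj : Φ₁ 1 τ = Φ₂ 0 τ) :
    transFence Φ₁ Φ₂ θ τ = Φ₂ (sndHalf θ) τ := by
  rcases h.eq_or_lt with h' | h'
  · rw [transFence_of_le h'.symm.le, fstHalf_eq_one h'.symm, sndHalf_eq_zero h'.symm, hj]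
  · rw [transFence_of_gt h']

omit [TopologicalSpace M] in
/-- At `θ = 0`. [folklore] -/
@[simp] theorem transFence_zero (Φ₁ Φ₂ : I → ℝ → M) : transFence Φ₁ Φ₂ 0 = Φ₁ 0 := by
  rw [transFence_of_le (by norm_num), fstHalf_zero]

omit [TopologicalSpace M] in
/-- At `θ = 1`. [folklore] -/
@[simp] theorem transFence_one (Φ₁ Φ₂ : I → ℝ → M) : transFence Φ₁ Φ₂ 1 = Φ₂ 1 := by
  rw [transFence_of_gt (by norm_num), sndHalf_one]

/-! ## Transfer of local data along reparametrisations -/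

namespace LocalDatum

variable {A A' : Type*} {G : A → F.GermSpace} {G' : A' → F.GermSpace} {τ₀ ε ε' : ℝ} {U : Set A} {U' : Set A'}

/-- **Pulling a local datum back**: if `G' = G ∘ κ` on `U'` and `κ` maps `U'` into `U`, a datum for
`G` on `U` is a datum for `G'` on `U'`. [folklore] -/
def transfer (D : LocalDatum F G τ₀ ε U) (κ : A' → A) (hκ : MapsTo κ U' U) (hG : ∀ a ∈ U', G' a = G (κ a))
    (hε : ε' ≤ ε) : LocalDatum F G' τ₀ ε' U' where
  box := D.box
  box_mem := D.box_mem
  φ := D.φ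
  ψ := D.ψ
  germ_eq a ha := by rw [hG a ha]; exact D.germ_eq _ (hκ ha)
  pt_mem a ha := by rw [hG a ha]; exact D.pt_mem _ (hκ ha)
  φ_ψ τ hτ := D.φ_ψ τ (Ioo_subset_Ioo (by linarith) (by linarith) hτ)
  ψ_φ := D.ψ_φ
  ψ_cont := D.ψ_cont.mono (Ioo_subset_Ioo (by linarith) (by linarith))
  ψ_inj := D.ψ_inj.mono (Ioo_subset_Ioo (by linarith) (by linarith))

/-- The box of a transferred datum. [folklore] -/
@[simp] theorem transfer_box (D : LocalDatum F G τ₀ ε U) (κ : A' → A) (hκ : MapsTo κ U' U)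
    (hG : ∀ a ∈ U', G' a = G (κ a)) (hε : ε' ≤ ε) : (D.transfer κ hκ hG hε).box = D.box := rfl

/-- The height function of a transferred datum. [folklore] -/
@[simp] theorem transfer_ψ (D : LocalDatum F G τ₀ ε U) (κ : A' → A) (hκ : MapsTo κ U' U)
    (hG : ∀ a ∈ U', G' a = G (κ a)) (hε : ε' ≤ ε) : (D.transfer κ hκ hG hε).ψ = D.ψ := rfl

/-- **Changing the germ family of a datum near a base point where the local first integrals
agree**: a datum `D` for `G` on `U`, a family `G'` on `U'` whose base points lie in an open set
`O` on which `D.φ ∘ h_{D.box}` represents the germs of `G'` and lie on the plaque of `D.box` at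
height `D.ψ τ₀`, give a datum for `G'` with the same box and functions. [folklore] -/
def retarget (D : LocalDatum F G τ₀ ε U) (hgerm : ∀ a ∈ U', (G' a).germ = ↑(D.φ ∘ height D.box))
    (hpt : ∀ a ∈ U', ofLeafSpace (G' a).pt ∈ plaque D.box (D.ψ τ₀)) (hε : ε' ≤ ε) : LocalDatum F G' τ₀ ε' U' where
  box := D.box
  box_mem := D.box_mem
  φ := D.φ
  ψ := D.ψ
  germ_eq := hgerm
  pt_mem := hpt
  φ_ψ τ hτ := D.φ_ψ τ (Ioo_subset_Ioo (by linarith) (by linarith) hτ)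
  ψ_φ := D.ψ_φ
  ψ_cont := D.ψ_cont.mono (Ioo_subset_Ioo (by linarith) (by linarith))
  ψ_inj := D.ψ_inj.mono (Ioo_subset_Ioo (by linarith) (by linarith))

/-- The box of a retargeted datum. [folklore] -/
@[simp] theorem retarget_box (D : LocalDatum F G τ₀ ε U) (hgerm : ∀ a ∈ U', (G' a).germ = ↑(D.φ ∘ height D.box))
    (hpt : ∀ a ∈ U', ofLeafSpace (G' a).pt ∈ plaque D.box (D.ψ τ₀)) (hε : ε' ≤ ε) :
    (D.retarget hgerm hpt hε).box = D.box := rfl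

/-- The height function of a retargeted datum. [folklore] -/
@[simp] theorem retarget_ψ (D : LocalDatum F G τ₀ ε U) (hgerm : ∀ a ∈ U', (G' a).germ = ↑(D.φ ∘ height D.box))
    (hpt : ∀ a ∈ U', ofLeafSpace (G' a).pt ∈ plaque D.box (D.ψ τ₀)) (hε : ε' ≤ ε) :
    (D.retarget hgerm hpt hε).ψ = D.ψ := rfl

end LocalDatum

/-! ## Constancy of heights along paths of constant height -/

/-- **Along a path in the intersection of two flow boxes of the atlas on which the height in the
first box is constant, the height in the second box is constant** (it is locally a function of the
first height, and the parameter interval is connected). [folklore] -/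
theorem height_eq_of_path {e e' : OpenPartialHomeomorph M (B × ℝ)} (he : e ∈ F.atlas) (he' : e' ∈ F.atlas)
    {a b : ℝ} (hab : a ≤ b) {c : ℝ → M} (hc : ContinuousOn c (Icc a b))
    (hsrc : ∀ s ∈ Icc a b, c s ∈ e.source ∩ e'.source) (hconst : ∀ s ∈ Icc a b, height e (c s) = height e (c a)) :
    ∀ s ∈ Icc a b, height e' (c s) = height e' (c a) := by
  -- the set of good parameters is clopen in `[a, b]`
  haveI : PreconnectedSpace (Icc a b) := Subtype.preconnectedSpace isPreconnected_Icc
  have key : ∀ s ∈ Icc a b, ∀ᶠ s' in 𝓝[Icc a b] s, height e' (c s') = height e' (c s) := by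
    intro s hs
    have hev := F.height_eventuallyEq_transition_comp_height he he' (hsrc s hs).1 (hsrc s hs).2
    have htend : Tendsto c (𝓝[Icc a b] s) (𝓝 (c s)) := hc s hs
    filter_upwards [htend.eventually hev, self_mem_nhdsWithin] with s' hs' hsI
    rw [hs', hev.self_of_nhds]
    simp only [comp_apply]
    rw [hconst s' hsI, hconst s hs]
  set A : Set (Icc a b) := {s | height e' (c s) = height e' (c a)} with hA
  have hnhds : ∀ s : Icc a b, ∀ᶠ s' : Icc a b in 𝓝 s, height e' (c s') = height e' (c s) := by
    rintro ⟨s, hs⟩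
    have h := key s hs
    rw [nhdsWithin_eq_map_subtype_coe hs, eventually_map] at h
    exact h
  have hopen : IsOpen A := isOpen_iff_mem_nhds.2 fun s hs ↦ (hnhds s).mono fun s' h ↦ h.trans hs
  have hcompl : IsOpen Aᶜ := isOpen_iff_mem_nhds.2 fun s hs ↦ (hnhds s).mono fun s' h h' ↦ hs (h.symm.trans h')
  have hclopen : IsClopen A := ⟨isOpen_compl_iff.1 hcompl, hopen⟩
  rcases isClopen_iff.1 hclopen with h0 | huniv
  · have : (⟨a, le_rfl, hab⟩ : Icc a b) ∈ A := by show height e' (c a) = height e' (c a); rfl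
    rw [h0] at this
    exact absurd this (notMem_empty _)
  · intro s hs
    have : (⟨s, hs⟩ : Icc a b) ∈ A := by rw [huniv]; exact mem_univ _
    exact this

/-! ## Concatenation -/

namespace IsFenceOn

variable {d₀ d₁ d₂ : F.GermSpace} {Γ₁ : Path d₀ d₁} {Γ₂ : Path d₁ d₂} {τ₀ ε : ℝ} {Φ₁ Φ₂ : I → ℝ → M}

/-- The fence of the first half, as a fence over `[0, 1/2]` for the concatenated path. [folklore] -/
theorem transFence_left (h₁ : IsFenceOn F Γ₁ τ₀ ε Φ₁ univ) :
    IsFenceOn F (Γ₁.trans Γ₂) τ₀ ε (transFence Φ₁ Φ₂) {θ | (θ : ℝ) ≤ 1 / 2} := by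
  refine ⟨?_, fun θ hθ ↦ ?_, fun θ hθ ↦ ?_⟩
  · have hc : ContinuousOn (fun p : I × ℝ ↦ uncurry Φ₁ (fstHalf p.1, p.2)) ({θ : I | (θ : ℝ) ≤ 1 / 2} ×ˢ Ioo (τ₀ - ε) (τ₀ + ε)) :=
      h₁.cont.comp (continuous_fstHalf.prodMap continuous_id).continuousOn fun p hp ↦ ⟨mem_univ _, hp.2⟩
    exact hc.congr fun p hp ↦ by simp only [uncurry, transFence_of_le (show ((p.1 : I) : ℝ) ≤ 1 / 2 from hp.1)]
  · rw [transFence_of_le hθ, Path.trans_apply_of_le _ _ hθ]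
    exact h₁.base _ (mem_univ _)
  · obtain ⟨U, hU, D, hD⟩ := h₁.local_level (fstHalf θ) (mem_univ _)
    have hU' : fstHalf ⁻¹' U ∈ 𝓝 θ := continuous_fstHalf.continuousAt.preimage_mem_nhds hU
    refine ⟨fstHalf ⁻¹' U, hU', D.transfer fstHalf (fun a ha ↦ ⟨ha.1, mem_univ _⟩)
      (fun a ha ↦ Path.trans_apply_of_le _ _ ha.2) le_rfl, fun a ha τ hτ ↦ ?_⟩
    rw [LocalDatum.transfer_box, LocalDatum.transfer_ψ, transFence_of_le (show ((a : I) : ℝ) ≤ 1 / 2 from ha.2)]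
    exact hD _ ⟨ha.1, mem_univ _⟩ τ hτ

/-- The fence of the second half, as a fence over `(1/2, 1]` for the concatenated path. [folklore] -/
theorem transFence_right (h₂ : IsFenceOn F Γ₂ τ₀ ε Φ₂ univ) :
    IsFenceOn F (Γ₁.trans Γ₂) τ₀ ε (transFence Φ₁ Φ₂) {θ | 1 / 2 < (θ : ℝ)} := by
  refine ⟨?_, fun θ hθ ↦ ?_, fun θ hθ ↦ ?_⟩
  · have hc : ContinuousOn (fun p : I × ℝ ↦ uncurry Φ₂ (sndHalf p.1, p.2)) ({θ : I | 1 / 2 < (θ : ℝ)} ×ˢ Ioo (τ₀ - ε) (τ₀ + ε)) :=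
      h₂.cont.comp (continuous_sndHalf.prodMap continuous_id).continuousOn fun p hp ↦ ⟨mem_univ _, hp.2⟩
    exact hc.congr fun p hp ↦ by simp only [uncurry, transFence_of_gt (show 1 / 2 < ((p.1 : I) : ℝ) from hp.1)]
  · have hθ' : 1 / 2 < (θ : ℝ) := hθ
    rw [transFence_of_gt hθ', Path.trans_apply_of_ge _ _ hθ'.le]
    exact h₂.base _ (mem_univ _)
  · have hθ' : 1 / 2 < (θ : ℝ) := hθ
    obtain ⟨U, hU, D, hD⟩ := h₂.local_level (sndHalf θ) (mem_univ _)
    have hU' : sndHalf ⁻¹' U ∈ 𝓝 θ := continuous_sndHalf.continuousAt.preimage_mem_nhds hU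
    refine ⟨sndHalf ⁻¹' U, hU', D.transfer sndHalf (fun a ha ↦ ⟨ha.1, mem_univ _⟩)
      (fun a ha ↦ Path.trans_apply_of_ge _ _ (le_of_lt ha.2)) le_rfl, fun a ha τ hτ ↦ ?_⟩
    rw [LocalDatum.transfer_box, LocalDatum.transfer_ψ, transFence_of_gt (show 1 / 2 < ((a : I) : ℝ) from ha.2)]
    exact hD _ ⟨ha.1, mem_univ _⟩ τ hτ

/-- **Concatenation of fences.** See the module docstring. [folklore] -/
theorem trans (h₁ : IsFenceOn F Γ₁ τ₀ ε Φ₁ univ) (h₂ : IsFenceOn F Γ₂ τ₀ ε Φ₂ univ)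
    (hjoin : ∀ τ ∈ Ioo (τ₀ - ε) (τ₀ + ε), Φ₁ 1 τ = Φ₂ 0 τ) {ε' : ℝ} (hε' : 0 < ε') (hε'ε : ε' < ε) :
    IsFenceOn F (Γ₁.trans Γ₂) τ₀ ε' (transFence Φ₁ Φ₂) univ := by
  have hε : 0 < ε := hε'.trans hε'ε
  have hL := transFence_left (Γ₂ := Γ₂) (Φ₂ := Φ₂) h₁
  have hR := transFence_right (Γ₁ := Γ₁) (Φ₁ := Φ₁) h₂
  have hI : Ioo (τ₀ - ε') (τ₀ + ε') ⊆ Ioo (τ₀ - ε) (τ₀ + ε) := Ioo_subset_Ioo (by linarith) (by linarith)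
  have hIc : Icc (τ₀ - ε') (τ₀ + ε') ⊆ Ioo (τ₀ - ε) (τ₀ + ε) := fun τ hτ ↦ ⟨by linarith [hτ.1], by linarith [hτ.2]⟩
  have hτ₀ : τ₀ ∈ Ioo (τ₀ - ε) (τ₀ + ε) := ⟨by linarith, by linarith⟩
  refine ⟨?_, fun θ _ ↦ ?_, fun θ _ ↦ ?_⟩
  · -- continuity: pasting along `θ = 1/2`
    have hc : ContinuousOn (fun p : I × ℝ ↦ if ((p.1 : I) : ℝ) ≤ 1 / 2 then uncurry Φ₁ (fstHalf p.1, p.2)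
        else uncurry Φ₂ (sndHalf p.1, p.2)) (univ ×ˢ Ioo (τ₀ - ε') (τ₀ + ε')) := by
      refine ContinuousOn.if ?_ ?_ ?_
      · rintro ⟨θ, τ⟩ ⟨⟨-, hτ⟩, hfr⟩
        -- on the frontier `θ = 1/2`
        have hclosed : IsClosed {p : I × ℝ | ((p.1 : I) : ℝ) ≤ 1 / 2} :=
          isClosed_le (continuous_subtype_val.comp continuous_fst) continuous_const
        have hclosed' : IsClosed {p : I × ℝ | 1 / 2 ≤ ((p.1 : I) : ℝ)} :=
          isClosed_le continuous_const (continuous_subtype_val.comp continuous_fst)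
        have h1 : (θ : ℝ) ≤ 1 / 2 := hclosed.closure_subset (frontier_subset_closure hfr)
        have h2 : 1 / 2 ≤ (θ : ℝ) := by
          have hcl : (θ, τ) ∈ closure ({p : I × ℝ | ((p.1 : I) : ℝ) ≤ 1 / 2}ᶜ) := by
            rw [closure_compl]; exact hfr.2
          have hsub : ({p : I × ℝ | ((p.1 : I) : ℝ) ≤ 1 / 2}ᶜ) ⊆ {p : I × ℝ | 1 / 2 ≤ ((p.1 : I) : ℝ)} :=
            fun p hp ↦ by
              simp only [mem_compl_iff, mem_setOf_eq, not_le] at hp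
              exact hp.le
          exact hclosed'.closure_subset (closure_mono hsub hcl)
        have hθ : (θ : ℝ) = 1 / 2 := le_antisymm h1 h2
        simp only [uncurry, fstHalf_eq_one hθ, sndHalf_eq_zero hθ]
        exact hjoin τ (hI hτ)
      · exact (h₁.cont.comp (continuous_fstHalf.prodMap continuous_id).continuousOn
          fun p hp ↦ ⟨mem_univ _, hI hp.1.2⟩)
      · exact (h₂.cont.comp (continuous_sndHalf.prodMap continuous_id).continuousOn
          fun p hp ↦ ⟨mem_univ _, hI hp.1.2⟩)
    refine hc.congr ?_
    rintro ⟨θ, τ⟩ -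
    simp only [uncurry, transFence]
    split_ifs <;> rfl
  · -- base
    rcases le_or_gt (θ : ℝ) (1 / 2) with hθ | hθ
    · exact hL.base θ hθ
    · exact hR.base θ hθ
  · -- local levels
    rcases lt_trichotomy (θ : ℝ) (1 / 2) with hθ | hθ | hθ
    · obtain ⟨U, hU, D, hD⟩ := hL.local_level θ hθ.le
      have hO : {a : I | (a : ℝ) < 1 / 2} ∈ 𝓝 θ := (isOpen_lt continuous_subtype_val continuous_const).mem_nhds hθ
      refine ⟨U ∩ {a : I | (a : ℝ) < 1 / 2}, inter_mem hU hO,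
        D.restrict (fun a ha ↦ ⟨ha.1.1, show (a : ℝ) ≤ 1 / 2 from le_of_lt ha.1.2⟩) hε'ε.le, fun a ha τ hτ ↦ ?_⟩
      rw [LocalDatum.restrict_box, LocalDatum.restrict_ψ]
      exact hD a ⟨ha.1.1, show (a : ℝ) ≤ 1 / 2 from le_of_lt ha.1.2⟩ τ (hI hτ)
    · -- the junction
      obtain ⟨U₁, hU₁, D₁, hD₁⟩ := h₁.local_level 1 (mem_univ _)
      obtain ⟨U₂, hU₂, D₂, hD₂⟩ := h₂.local_level 0 (mem_univ _)
      have h1U₁ : (1 : I) ∈ U₁ ∩ univ := ⟨mem_of_mem_nhds hU₁, mem_univ _⟩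
      have h0U₂ : (0 : I) ∈ U₂ ∩ univ := ⟨mem_of_mem_nhds hU₂, mem_univ _⟩
      -- the junction base point `z₁` and the two local first integrals near it
      set z₁ : M := ofLeafSpace d₁.pt with hz₁
      have hz₁E₁ : z₁ ∈ plaque D₁.box (D₁.ψ τ₀) := by
        have := D₁.pt_mem 1 h1U₁; rwa [Γ₁.target] at this
      have hz₁E₂ : z₁ ∈ plaque D₂.box (D₂.ψ τ₀) := by
        have := D₂.pt_mem 0 h0U₂; rwa [Γ₂.source] at this
      have hgerm : ∀ᶠ w in 𝓝 z₁, D₁.φ (height D₁.box w) = D₂.φ (height D₂.box w) := by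
        have e1 := D₁.germ_eq 1 h1U₁
        have e2 := D₂.germ_eq 0 h0U₂
        rw [Γ₁.target] at e1
        rw [Γ₂.source] at e2
        exact Germ.coe_eq.1 (e1.symm.trans e2)
      have hψφ : ∀ᶠ w in 𝓝 z₁, D₁.ψ (D₁.φ (height D₁.box w)) = height D₁.box w := by
        have hc : ContinuousAt (height D₁.box) z₁ := continuousAt_height hz₁E₁.1
        have := D₁.ψ_φ
        rw [← hz₁E₁.2] at this
        exact hc.eventually this
      obtain ⟨O, hOsub, hOo, hz₁O⟩ := mem_nhds_iff.1 (inter_mem (inter_mem hgerm hψφ)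
        (inter_mem (D₁.box.open_source.mem_nhds hz₁E₁.1) (D₂.box.open_source.mem_nhds hz₁E₂.1)))
      have hOgerm : ∀ w ∈ O, D₁.φ (height D₁.box w) = D₂.φ (height D₂.box w) := fun w hw ↦ (hOsub hw).1.1
      have hOψφ : ∀ w ∈ O, D₁.ψ (D₁.φ (height D₁.box w)) = height D₁.box w := fun w hw ↦ (hOsub hw).1.2
      have hOE₁ : ∀ w ∈ O, w ∈ D₁.box.source := fun w hw ↦ (hOsub hw).2.1
      -- the base points of the concatenated path near `θ` lie in `O`
      set ptmap : I → M := fun a ↦ ofLeafSpace ((Γ₁.trans Γ₂) a).pt with hptmap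
      have hptc : Continuous ptmap := F.continuous_ofLeafSpace_pt (Γ₁.trans Γ₂ : C(I, F.GermSpace))
      have hptθ : ptmap θ = z₁ := by
        show ofLeafSpace ((Γ₁.trans Γ₂) θ).pt = z₁
        rw [Path.trans_apply_of_le _ _ hθ.le, fstHalf_eq_one hθ, Γ₁.target]
      have hV : ptmap ⁻¹' O ∈ 𝓝 θ := hptc.continuousAt.preimage_mem_nhds (by rw [hptθ]; exact hOo.mem_nhds hz₁O)
      -- tube: `Φ₂ s τ ∈ D₁.box.source` for small `s` and `τ ∈ [τ₀ - ε', τ₀ + ε']`, and `s ∈ U₂`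
      obtain ⟨s₀, hs₀, hsmall⟩ : ∃ s₀ > (0 : ℝ), ∀ s : I, (s : ℝ) < s₀ → s ∈ U₂ ∧
          ∀ τ ∈ Icc (τ₀ - ε') (τ₀ + ε'), Φ₂ s τ ∈ D₁.box.source := by
        have hW : IsOpen ((univ : Set I) ×ˢ Ioo (τ₀ - ε) (τ₀ + ε)) := isOpen_univ.prod isOpen_Ioo
        have hP : IsOpen ((univ : Set I) ×ˢ Ioo (τ₀ - ε) (τ₀ + ε) ∩ uncurry Φ₂ ⁻¹' D₁.box.source) :=
          h₂.cont.isOpen_inter_preimage hW D₁.box.open_source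
        have hsub : ({(0 : I)} : Set I) ×ˢ Icc (τ₀ - ε') (τ₀ + ε') ⊆
            (univ : Set I) ×ˢ Ioo (τ₀ - ε) (τ₀ + ε) ∩ uncurry Φ₂ ⁻¹' D₁.box.source := by
          rintro ⟨s, τ⟩ ⟨hs, hτ⟩
          rw [mem_singleton_iff] at hs
          subst hs
          refine ⟨⟨mem_univ _, hIc hτ⟩, ?_⟩
          show Φ₂ 0 τ ∈ D₁.box.source
          rw [← hjoin τ (hIc hτ)]
          exact (hD₁ 1 h1U₁ τ (hIc hτ)).1
        obtain ⟨u, v, hu, -, h0u, htv, huv⟩ := generalized_tube_lemma isCompact_singleton isCompact_Icc hP hsub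
        have hu0 : u ∩ interior U₂ ∈ 𝓝 (0 : I) :=
          inter_mem (hu.mem_nhds (h0u rfl)) (interior_mem_nhds.2 hU₂)
        obtain ⟨s₀, hs₀, hball⟩ := Metric.mem_nhds_iff.1 hu0
        refine ⟨s₀, hs₀, fun s hs ↦ ?_⟩
        have hsb : s ∈ Metric.ball (0 : I) s₀ := by
          rw [Metric.mem_ball, Subtype.dist_eq, Set.Icc.coe_zero, dist_zero_right, Real.norm_of_nonneg s.2.1]
          exact hs
        obtain ⟨hsu, hsU⟩ := hball hsb
        refine ⟨interior_subset hsU, fun τ hτ ↦ ?_⟩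
        have h := huv (mk_mem_prod hsu (htv hτ))
        exact h.2
      -- the neighbourhood of `θ`
      have hN₁ : fstHalf ⁻¹' U₁ ∈ 𝓝 θ :=
        continuous_fstHalf.continuousAt.preimage_mem_nhds (by rw [fstHalf_eq_one hθ]; exact hU₁)
      have hN₂ : sndHalf ⁻¹' {s : I | (s : ℝ) < s₀} ∈ 𝓝 θ :=
        continuous_sndHalf.continuousAt.preimage_mem_nhds (by
          rw [sndHalf_eq_zero hθ]
          exact (isOpen_lt continuous_subtype_val continuous_const).mem_nhds (by show ((0 : I) : ℝ) < s₀; simpa using hs₀))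
      set U : Set I := ptmap ⁻¹' O ∩ (fstHalf ⁻¹' U₁ ∩ sndHalf ⁻¹' {s : I | (s : ℝ) < s₀}) with hUdef
      have hU : U ∈ 𝓝 θ := inter_mem hV (inter_mem hN₁ hN₂)
      -- facts on `U`
      have hleft : ∀ a ∈ U, (a : ℝ) ≤ 1 / 2 → fstHalf a ∈ U₁ ∩ univ := fun a ha _ ↦ ⟨ha.2.1, mem_univ _⟩
      have hright : ∀ a ∈ U, 1 / 2 < (a : ℝ) → (sndHalf a : ℝ) < s₀ := fun a ha _ ↦ ha.2.2
      -- the germs of the concatenated path on `U` are represented by `D₁.φ ∘ h_{D₁.box}`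
      have hgerm' : ∀ a ∈ U ∩ univ, ((Γ₁.trans Γ₂) a).germ = ↑(D₁.φ ∘ height D₁.box) := by
        rintro a ⟨ha, -⟩
        rcases le_or_gt (a : ℝ) (1 / 2) with hle | hgt
        · rw [Path.trans_apply_of_le _ _ hle]
          exact D₁.germ_eq _ (hleft a ha hle)
        · have hs := hright a ha hgt
          have hO' : ofLeafSpace ((Γ₁.trans Γ₂) a).pt ∈ O := ha.1
          rw [Path.trans_apply_of_ge _ _ hgt.le] at hO' ⊢
          rw [D₂.germ_eq _ ⟨(hsmall _ hs).1, mem_univ _⟩, Germ.coe_eq]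
          exact Filter.eventuallyEq_of_mem (hOo.mem_nhds hO') fun w hw ↦ (hOgerm w hw).symm
      have hpt' : ∀ a ∈ U ∩ univ, ofLeafSpace ((Γ₁.trans Γ₂) a).pt ∈ plaque D₁.box (D₁.ψ τ₀) := by
        rintro a ⟨ha, -⟩
        rcases le_or_gt (a : ℝ) (1 / 2) with hle | hgt
        · rw [Path.trans_apply_of_le _ _ hle]
          exact D₁.pt_mem _ (hleft a ha hle)
        · have hs := hright a ha hgt
          have hO' : ofLeafSpace ((Γ₁.trans Γ₂) a).pt ∈ O := ha.1
          rw [Path.trans_apply_of_ge _ _ hgt.le] at hO' ⊢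
          have hE₂ := D₂.pt_mem _ ⟨(hsmall _ hs).1, mem_univ _⟩
          refine ⟨hOE₁ _ hO', ?_⟩
          show height D₁.box _ = _
          have hh : height D₂.box (ofLeafSpace (Γ₂ (sndHalf a)).pt) = D₂.ψ τ₀ := hE₂.2
          rw [← hOψφ _ hO', hOgerm _ hO', hh, D₂.φ_ψ τ₀ hτ₀]
      refine ⟨U, hU, D₁.retarget hgerm' hpt' hε'ε.le, ?_⟩
      rintro a ⟨ha, -⟩ τ hτ
      rw [LocalDatum.retarget_box, LocalDatum.retarget_ψ]
      rcases le_or_gt (a : ℝ) (1 / 2) with hle | hgt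
      · rw [transFence_of_le hle]
        exact hD₁ _ (hleft a ha hle) τ (hI hτ)
      · have hs := hright a ha hgt
        rw [transFence_of_gt hgt]
        set s : I := sndHalf a with hsdef
        -- the path `r ↦ Φ₂ r τ`, `r ∈ [0, s]`, has constant `D₂`-height, hence constant `D₁`-height
        have hmem : ∀ r ∈ Icc (0 : ℝ) s, (projIcc 0 1 zero_le_one r : ℝ) = r := fun r hr ↦ by
          rw [projIcc_of_mem _ ⟨hr.1, hr.2.trans s.2.2⟩]
        have hpath := F.height_eq_of_path D₂.box_mem D₁.box_mem s.2.1
          (c := fun r ↦ Φ₂ (projIcc 0 1 zero_le_one r) τ) ?_ ?_ ?_ s ⟨s.2.1, le_rfl⟩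
        · simp only [projIcc_val] at hpath
          refine ⟨(hsmall s hs).2 τ (Ioo_subset_Icc_self hτ), ?_⟩
          rw [hpath, projIcc_left]
          change height D₁.box (Φ₂ 0 τ) = D₁.ψ τ
          rw [← hjoin τ (hI hτ)]
          exact (hD₁ 1 h1U₁ τ (hI hτ)).2
        · have hc : Continuous fun r : ℝ ↦ ((projIcc 0 1 zero_le_one r, τ) : I × ℝ) :=
            continuous_projIcc.prodMk continuous_const
          exact h₂.cont.comp hc.continuousOn fun r _ ↦ ⟨mem_univ _, hI hτ⟩
        · intro r hr
          have hr' : ((projIcc 0 1 zero_le_one r : I) : ℝ) < s₀ := by rw [hmem r hr]; exact hr.2.trans_lt hs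
          exact ⟨(hD₂ _ ⟨(hsmall _ hr').1, mem_univ _⟩ τ (hI hτ)).1, (hsmall _ hr').2 τ (Ioo_subset_Icc_self hτ)⟩
        · intro r hr
          have hr' : ((projIcc 0 1 zero_le_one r : I) : ℝ) < s₀ := by rw [hmem r hr]; exact hr.2.trans_lt hs
          have h0' : ((projIcc 0 1 zero_le_one (0 : ℝ) : I) : ℝ) < s₀ := by rw [projIcc_left]; simpa using hs₀
          rw [(hD₂ _ ⟨(hsmall _ hr').1, mem_univ _⟩ τ (hI hτ)).2, (hD₂ _ ⟨(hsmall _ h0').1, mem_univ _⟩ τ (hI hτ)).2]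
    · obtain ⟨U, hU, D, hD⟩ := hR.local_level θ hθ
      have hO : {a : I | 1 / 2 < (a : ℝ)} ∈ 𝓝 θ := (isOpen_lt continuous_const continuous_subtype_val).mem_nhds hθ
      refine ⟨U ∩ {a : I | 1 / 2 < (a : ℝ)}, inter_mem hU hO,
        D.restrict (fun a ha ↦ ⟨ha.1.1, ha.1.2⟩) hε'ε.le, fun a ha τ hτ ↦ ?_⟩
      rw [LocalDatum.restrict_box, LocalDatum.restrict_ψ]
      exact hD a ⟨ha.1.1, ha.1.2⟩ τ (hI hτ)

end IsFenceOn

end Foliation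

end Literature.Topology.FourManifolds
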